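import Summits.BirchSwinnertonDyer.BirchSwinnertonDyer.Theorems.KimAtThreeFineKatoDefinedLambda
import HarnessLib

/-!
# Kato's value datum DEFINED, VI — UNIQUENESS: any `Λ` with the displayed (DEF₀) IS `katoLambda`; the defined datum does
# not depend on the twist family `g` (crux `KatoKuriharaPortThreeShared`, stmt-BirchSwinnertonDyer-19560; cell `bsd-addord`,
# seat w2-acc5 gen 6; route W2 `KimAtThreeKolyvagin`; `--supports 19560`, helper)

HONEST FRAMING.  TOOL theorems (no definition, no named fact, no instance, no `sorry`); closes nothing; nothing is booked;
BSD is not proved by any of this.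

WHAT (every `p`, `k`, `r`).
* `eq_katoLambda_of_cocycleDef` — **a value datum `Λ_{k,r}` satisfying the displayed clause (DEF₀) for a chart
  `(Ψ, w₀, g, dw)` EQUALS `katoLambda … Ψ … w₀ … g … dw …`** (`Ψ` is injective; every `g_w · y` has a cocycle and a tower
  cocycle, w2-acc4 `exists_level_towerCocycle`; `cocycleDef_katoLambda`).  So every package of crux 19560 that binds `∃ Λ` with
  (DEF₀) at every level (the LEAD's `hKatoP`; a Literature re-typing with a (DEF₀)-type clause) converts to the `katoLambda` form
  of `KimAtThreeFineKatoDefinedLambdaKatoV2` by name, and two such `Λ` agree (`eq_of_cocycleDef_of_cocycleDef`).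
* `definedLambdaHom_eq_of_galStab` / `definedLambda_eq_of_galStab` — **independence of the twist family**: for an additive `F`
  with the stabiliser equivariance (GAL₀) «`F (δ · Y) = δ̃_* (F Y)` whenever `δ̃ • w₀ = w₀`» (for `F = exp*_{w₀} ∘ loc^{tower}_{w₀}`:
  w2-acc5 g5 `KimAtThreeFineKatoValueEquivarianceStabAll` ∘ kim3 `expStarOmega_galois`), the single-completion datum built with
  two twist families `g, g'` (`g̃_w • w = w₀ = g̃'_w • w`) is THE SAME map — the cocycle law `(g̃'_w⁻¹)_* ∘ δ̃_* = (g̃_w⁻¹)_*` for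
  `δ = g'_w g_w⁻¹` (Cassels–Fröhlich VII §1.1); one half of «`katoLambda` is canonical given (RES₀)» (the other half, independence
  of `w₀`, needs transport of the line datum between completions and is not in this file).

References: K. Kato, Astérisque 295 (2004) §9.4 [Kato2004Asterisque]; J. W. S. Cassels, A. Fröhlich (1967) Ch. II §10 (10.2),
Ch. VII §1.1 [CasselsFrohlichANT1967]; J.-P. Serre, *Galois Cohomology* (1997) I §2.4 [SerreGaloisCohomology1997].
-/

noncomputable section

-- the cell's Theorems namespace `Summit.BirchSwinnertonDyer.BirchSwinnertonDyer.…` repeats the summit name by design (D-0017)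
set_option linter.dupNamespace false

open scoped Classical NumberField ContRepresentation TensorProduct Pointwise
open Field ValuativeRel NumberField IsDedekindDomain
open WeierstrassCurve Literature.NumberTheory.EllipticCurves Literature.NumberTheory.GaloisRepresentations
  Literature.NumberTheory.GaloisRepresentations.DiscreteGaloisModule
  Literature.NumberTheory.EllipticCurves.Kato2004.EulerSystemValues
open Literature.NumberTheory.GaloisRepresentations.PeriodRingData Literature.NumberTheory.PAdicHodge
open Literature.NumberTheory.AdelicBaseChange Literature.NumberTheory.Automorphic
open Summit.BirchSwinnertonDyer.Rank1Residual.GaloisImage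
open Summit.BirchSwinnertonDyer.BirchSwinnertonDyer.Theorems.KimAtThreeFineKatoLevelCompat
open Summit.BirchSwinnertonDyer.BirchSwinnertonDyer.Theorems.KimAtThreeFineKatoLevelCompatDef
open Summit.BirchSwinnertonDyer.BirchSwinnertonDyer.Theorems.KimAtThreeDeepLowerExpStarOmega
open Summit.BirchSwinnertonDyer.BirchSwinnertonDyer.Theorems.KimAtThreeDeepLowerExpStarOmegaPlace
open Summit.BirchSwinnertonDyer.BirchSwinnertonDyer.Theorems.KimAtThreeFineKatoDefinedLambda

namespace Summit.BirchSwinnertonDyer.BirchSwinnertonDyer.Theorems.KimAtThreeFineKatoDefinedLambdaUnique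

variable (W : WeierstrassCurve ℚ) [W.IsElliptic] (p : ℕ) [hp : Fact p.Prime]
  [ContinuousSMul ℤ_[p] (W.tateModule p)] (k : ℕ) (r : Finset (HeightOneSpectrum (𝓞 ℚ)))
  (Ψ : ℚ_[p] ⊗[ℚ] CyclotomicField (cycLevel p k r) ℚ ≃ₐ[ℚ]
    (Π w : ((Rat.HeightOneSpectrum.primesEquiv (R := 𝓞 ℚ)).symm ⟨p, Fact.out⟩).Extension
      (𝓞 (CyclotomicField (cycLevel p k r) ℚ)), w.1.adicCompletion (CyclotomicField (cycLevel p k r) ℚ)))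
  (w₀ : ((Rat.HeightOneSpectrum.primesEquiv (R := 𝓞 ℚ)).symm ⟨p, Fact.out⟩).Extension
    (𝓞 (CyclotomicField (cycLevel p k r) ℚ)))

/-! ### §1 Independence of the twist family (abstract `F` with the stabiliser equivariance) -/

section Twist

variable (F : H1 (tateRep W p) (cycSubgroup p k r) →+ w₀.1.adicCompletion (CyclotomicField (cycLevel p k r) ℚ))
  (g g' : ((Rat.HeightOneSpectrum.primesEquiv (R := 𝓞 ℚ)).symm ⟨p, Fact.out⟩).Extension
    (𝓞 (CyclotomicField (cycLevel p k r) ℚ)) → absoluteGaloisGroup ℚ)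
  (hg : ∀ w : ((Rat.HeightOneSpectrum.primesEquiv (R := 𝓞 ℚ)).symm ⟨p, Fact.out⟩).Extension
      (𝓞 (CyclotomicField (cycLevel p k r) ℚ)),
    sigma (cycLevel p k r) (modNCyclotomicCharacter ℚ (cycLevel p k r) (g w)) • w.1 = w₀.1)
  (hg' : ∀ w : ((Rat.HeightOneSpectrum.primesEquiv (R := 𝓞 ℚ)).symm ⟨p, Fact.out⟩).Extension
      (𝓞 (CyclotomicField (cycLevel p k r) ℚ)),
    sigma (cycLevel p k r) (modNCyclotomicCharacter ℚ (cycLevel p k r) (g' w)) • w.1 = w₀.1)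
  (hgal : ∀ (δ : absoluteGaloisGroup ℚ)
    (hδ : sigma (cycLevel p k r) (modNCyclotomicCharacter ℚ (cycLevel p k r) δ) • w₀.1 = w₀.1)
    (Y : H1 (tateRep W p) (cycSubgroup p k r)),
    F (conjMap (tateRep W p).toTopRep (cycSubgroup p k r) δ 1 Y) =
      galAdicCompletionMap (sigma (cycLevel p k r) (modNCyclotomicCharacter ℚ (cycLevel p k r) δ)) hδ (F Y))

include hgal in
set_option backward.isDefEq.respectTransparency false in
/-- **The single-completion datum does not depend on the twist family**: under (GAL₀) for `F`,
`semiLocalValue … F g hg = semiLocalValue … F g' hg'` (`δ := g'_w g_w⁻¹` fixes `w₀`; `F (g'_w · y) = δ̃_* F (g_w · y)`; cocycle law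
`(g̃'_w⁻¹)_* ∘ δ̃_* = (g̃_w⁻¹)_*`). [cite: CasselsFrohlichANT1967, Ch. VII §1.1] [cite: Kato2004Asterisque, §9.4 (p. 188)] -/
theorem semiLocalValue_eq_of_galStab (y : H1 (tateRep W p) (cycSubgroup p k r)) :
    semiLocalValue W p k r w₀ F g hg y = semiLocalValue W p k r w₀ F g' hg' y := by
  -- `g̃ τ = sigma m (χ_m τ)` is a group homomorphism `Γ_ℚ → Aut(L/ℚ)`
  let gt : absoluteGaloisGroup ℚ →*
      (CyclotomicField (cycLevel p k r) ℚ ≃ₐ[ℚ] CyclotomicField (cycLevel p k r) ℚ) :=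
    ((IsCyclotomicExtension.autEquivPow (CyclotomicField (cycLevel p k r) ℚ)
      (Polynomial.cyclotomic.irreducible_rat (NeZero.pos (cycLevel p k r)))).symm.toMonoidHom).comp
      (modNCyclotomicCharacter ℚ (cycLevel p k r))
  have hgt : ∀ τ, gt τ = sigma (cycLevel p k r) (modNCyclotomicCharacter ℚ (cycLevel p k r) τ) :=
    fun _ => rfl
  funext w
  rw [semiLocalValue_apply, semiLocalValue_apply]
  -- `δ := g'_w g_w⁻¹` fixes `w₀`
  have h1 : (gt (g w))⁻¹ • w₀.1 = w.1 := inv_smul_eq_of_smul_eq (hg w)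
  have hδ : sigma (cycLevel p k r) (modNCyclotomicCharacter ℚ (cycLevel p k r) (g' w * (g w)⁻¹)) • w₀.1 = w₀.1 := by
    rw [← hgt, map_mul, map_inv, mul_smul, h1]
    exact hg' w
  have key : g' w = (g' w * (g w)⁻¹) * g w := by group
  have hgal' := hgal (g' w * (g w)⁻¹) hδ (conjMap (tateRep W p).toTopRep (cycSubgroup p k r) (g w) 1 y)
  rw [conjMap_conjMap, ← key] at hgal'
  rw [hgal', galAdicCompletionMap_galAdicCompletionMap]
  refine galAdicCompletionMap_congr_left _ ?_ _ _ _
  rw [← hgt, ← hgt, ← hgt, map_mul, map_inv]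
  group

include hgal in
/-- `definedLambdaHom` does not depend on the twist family (under (GAL₀) for `F`). [cite: Kato2004Asterisque, §9.4 (p. 188)] -/
theorem definedLambdaHom_eq_of_galStab :
    definedLambdaHom W p k r Ψ w₀ F g hg = definedLambdaHom W p k r Ψ w₀ F g' hg' := by
  ext y
  change Ψ.symm (semiLocalValue W p k r w₀ F g hg y) = Ψ.symm (semiLocalValue W p k r w₀ F g' hg' y)
  rw [semiLocalValue_eq_of_galStab W p k r w₀ F g g' hg hg' hgal y]

include hgal in
/-- **`definedLambda` does not depend on the twist family** (under (GAL₀) for `F`; any semilinearity witnesses `hF`).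
[cite: Kato2004Asterisque, §9.4 (p. 188)] [cite: CasselsFrohlichANT1967, Ch. VII §1.1] -/
theorem definedLambda_eq_of_galStab
    (hΨ : ∀ (s : ℚ_[p]) (x : CyclotomicField (cycLevel p k r) ℚ)
      (w : ((Rat.HeightOneSpectrum.primesEquiv (R := 𝓞 ℚ)).symm ⟨p, Fact.out⟩).Extension
        (𝓞 (CyclotomicField (cycLevel p k r) ℚ))),
      Ψ (s ⊗ₜ[ℚ] x) w = algebraMap (CyclotomicField (cycLevel p k r) ℚ)
          (w.1.adicCompletion (CyclotomicField (cycLevel p k r) ℚ)) x *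
        algebraMap (((Rat.HeightOneSpectrum.primesEquiv (R := 𝓞 ℚ)).symm ⟨p, Fact.out⟩).adicCompletion ℚ)
          (w.1.adicCompletion (CyclotomicField (cycLevel p k r) ℚ)) (Padic.adicCompletionEquiv (𝓞 ℚ) ⟨p, Fact.out⟩ s))
    (hF : ∀ (a : ℤ_[p]) (Y : H1 (tateRep W p) (cycSubgroup p k r)),
      F (a • Y) = algebraMap (((Rat.HeightOneSpectrum.primesEquiv (R := 𝓞 ℚ)).symm ⟨p, Fact.out⟩).adicCompletion ℚ)
          (w₀.1.adicCompletion (CyclotomicField (cycLevel p k r) ℚ))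
          (Padic.adicCompletionEquiv (𝓞 ℚ) ⟨p, Fact.out⟩ (a : ℚ_[p])) * F Y) :
    definedLambda W p k r Ψ w₀ F g hg hΨ hF = definedLambda W p k r Ψ w₀ F g' hg' hΨ hF := by
  apply LinearMap.ext
  intro y
  rw [definedLambda_apply, definedLambda_apply, definedLambdaHom_eq_of_galStab W p k r Ψ w₀ F g g' hg hg' hgal]

end Twist

/-! ### §2 Any `Λ` with (DEF₀) is `katoLambda` -/

section Unique

variable
  (hΨ : ∀ (s : ℚ_[p]) (x : CyclotomicField (cycLevel p k r) ℚ)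
    (w : ((Rat.HeightOneSpectrum.primesEquiv (R := 𝓞 ℚ)).symm ⟨p, Fact.out⟩).Extension
      (𝓞 (CyclotomicField (cycLevel p k r) ℚ))),
    Ψ (s ⊗ₜ[ℚ] x) w = algebraMap (CyclotomicField (cycLevel p k r) ℚ)
        (w.1.adicCompletion (CyclotomicField (cycLevel p k r) ℚ)) x *
      algebraMap (((Rat.HeightOneSpectrum.primesEquiv (R := 𝓞 ℚ)).symm ⟨p, Fact.out⟩).adicCompletion ℚ)
        (w.1.adicCompletion (CyclotomicField (cycLevel p k r) ℚ)) (Padic.adicCompletionEquiv (𝓞 ℚ) ⟨p, Fact.out⟩ s))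
  (hw₀ : ((p : ℕ) : 𝓞 (CyclotomicField (cycLevel p k r) ℚ)) ∈ w₀.1.asIdeal)
  (g : ((Rat.HeightOneSpectrum.primesEquiv (R := 𝓞 ℚ)).symm ⟨p, Fact.out⟩).Extension
    (𝓞 (CyclotomicField (cycLevel p k r) ℚ)) → absoluteGaloisGroup ℚ)
  (hg : ∀ w : ((Rat.HeightOneSpectrum.primesEquiv (R := 𝓞 ℚ)).symm ⟨p, Fact.out⟩).Extension
      (𝓞 (CyclotomicField (cycLevel p k r) ℚ)),
    sigma (cycLevel p k r) (modNCyclotomicCharacter ℚ (cycLevel p k r) (g w)) • w.1 = w₀.1)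

set_option backward.isDefEq.respectTransparency false in
/-- **A value datum with the displayed (DEF₀) IS `katoLambda`**: if `Ψ (Λ y)_w = (g̃_w⁻¹)_* (exp*_{w₀} [ψT])` for every `w`, `y`,
every cocycle `φ''` of `g_w · y` and every tower cocycle `ψT` (the clause the 19560 packages display), then
`Λ = katoLambda … Ψ … w₀ … g … dw hinjw hexw` (`Ψ` injective; representatives exist, w2-acc4 `exists_level_towerCocycle`;
`cocycleDef_katoLambda`). [cite: Kato2004Asterisque, §9.4 (p. 188)] [cite: SerreGaloisCohomology1997, I §2.4] -/
theorem eq_katoLambda_of_cocycleDef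
    (Λ : H1 (tateRep W p) (cycSubgroup p k r) →ₗ[ℤ_[p]] ℚ_[p] ⊗[ℚ] CyclotomicField (cycLevel p k r) ℚ) :
    letI := LocalField.charZero_adicCompletion w₀.1
    letI := LocalField.adicCompletionPadicAlgebra w₀.1 p hw₀
    haveI : Fact (¬ IsUnit ((p : ℕ) : integerC (w₀.1.adicCompletion (CyclotomicField (cycLevel p k r) ℚ)))) :=
      ⟨not_isUnit_natCast_integerC (LocalField.valuation_adicCompletion_natCast_lt_one w₀.1 p hw₀)⟩
    haveI := isAdicComplete_integerC_natCast (LocalField.valuation_adicCompletion_natCast_lt_one w₀.1 p hw₀)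
    ∀ (dw : LocalNeronLine W (LocalField.valuation_adicCompletion_natCast_lt_one w₀.1 p hw₀)
        ((galRestrictPlace ((Rat.HeightOneSpectrum.primesEquiv (R := 𝓞 ℚ)).symm ⟨p, Fact.out⟩)).comp
          (absGaloisRestrict (((Rat.HeightOneSpectrum.primesEquiv (R := 𝓞 ℚ)).symm ⟨p, Fact.out⟩).adicCompletion ℚ)
            (w₀.1.adicCompletion (CyclotomicField (cycLevel p k r) ℚ)))))
      (hinjw : (bdRPeriodRingData (LocalField.valuation_adicCompletion_natCast_lt_one w₀.1 p hw₀)).CupLogInjective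
        (logCyclotomic p) (localRationalTateRep W p ((galRestrictPlace ((Rat.HeightOneSpectrum.primesEquiv (R := 𝓞 ℚ)).symm ⟨p, Fact.out⟩)).comp
          (absGaloisRestrict (((Rat.HeightOneSpectrum.primesEquiv (R := 𝓞 ℚ)).symm ⟨p, Fact.out⟩).adicCompletion ℚ)
            (w₀.1.adicCompletion (CyclotomicField (cycLevel p k r) ℚ))))))
      (hexw : ∀ z : contOneCocycles (localRationalTateRep W p ((galRestrictPlace ((Rat.HeightOneSpectrum.primesEquiv (R := 𝓞 ℚ)).symm ⟨p, Fact.out⟩)).comp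
          (absGaloisRestrict (((Rat.HeightOneSpectrum.primesEquiv (R := 𝓞 ℚ)).symm ⟨p, Fact.out⟩).adicCompletion ℚ)
            (w₀.1.adicCompletion (CyclotomicField (cycLevel p k r) ℚ))))).toTopRep,
        (bdRPeriodRingData (LocalField.valuation_adicCompletion_natCast_lt_one w₀.1 p hw₀)).HasDualExp
          (logCyclotomic p) (localRationalTateRep W p ((galRestrictPlace ((Rat.HeightOneSpectrum.primesEquiv (R := 𝓞 ℚ)).symm ⟨p, Fact.out⟩)).comp
          (absGaloisRestrict (((Rat.HeightOneSpectrum.primesEquiv (R := 𝓞 ℚ)).symm ⟨p, Fact.out⟩).adicCompletion ℚ)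
            (w₀.1.adicCompletion (CyclotomicField (cycLevel p k r) ℚ))))) fun σ => z.1 σ),
      (∀ (w : ((Rat.HeightOneSpectrum.primesEquiv (R := 𝓞 ℚ)).symm ⟨p, Fact.out⟩).Extension
          (𝓞 (CyclotomicField (cycLevel p k r) ℚ)))
        (y : H1 (tateRep W p) (cycSubgroup p k r))
        (φ'' : contOneCocycles (subgroupRep (tateRep W p).toTopRep (cycSubgroup p k r)))
        (ψT : contOneCocycles ((tateLocalRep W p (Sum.inr ((Rat.HeightOneSpectrum.primesEquiv (R := 𝓞 ℚ)).symm ⟨p, Fact.out⟩))).restrict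
          (absGaloisRestrict (((Rat.HeightOneSpectrum.primesEquiv (R := 𝓞 ℚ)).symm ⟨p, Fact.out⟩).adicCompletion ℚ)
            (w₀.1.adicCompletion (CyclotomicField (cycLevel p k r) ℚ)))).toTopRep),
        oneCocycleClass _ φ'' = conjMap (tateRep W p).toTopRep (cycSubgroup p k r) (g w) 1 y →
        (∀ σ, ψT.1 σ = φ''.1 ⟨absGaloisRestrictTower ℚ (((Rat.HeightOneSpectrum.primesEquiv (R := 𝓞 ℚ)).symm ⟨p, Fact.out⟩).adicCompletion ℚ)
          (w₀.1.adicCompletion (CyclotomicField (cycLevel p k r) ℚ)) σ,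
          absGaloisRestrictTower_adicCompletion_mem_cycSubgroup_prime p k r w₀ σ⟩) →
        Ψ (Λ y) w = galAdicCompletionMap
          (sigma (cycLevel p k r) (modNCyclotomicCharacter ℚ (cycLevel p k r) (g w)))⁻¹
          (inv_smul_eq_of_smul_eq (hg w))
          (expStarOmegaHom (LocalField.valuation_adicCompletion_natCast_lt_one w₀.1 p hw₀)
            ((galRestrictPlace ((Rat.HeightOneSpectrum.primesEquiv (R := 𝓞 ℚ)).symm ⟨p, Fact.out⟩)).comp
              (absGaloisRestrict (((Rat.HeightOneSpectrum.primesEquiv (R := 𝓞 ℚ)).symm ⟨p, Fact.out⟩).adicCompletion ℚ)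
                (w₀.1.adicCompletion (CyclotomicField (cycLevel p k r) ℚ)))) dw hinjw hexw (oneCocycleClass _ ψT))) →
      Λ = katoLambda W p k r w₀ Ψ hΨ hw₀ g hg dw hinjw hexw := by
  intro dw hinjw hexw hdef
  letI := LocalField.charZero_adicCompletion w₀.1
  letI := LocalField.adicCompletionPadicAlgebra w₀.1 p hw₀
  haveI : Fact (¬ IsUnit ((p : ℕ) : integerC (w₀.1.adicCompletion (CyclotomicField (cycLevel p k r) ℚ)))) :=
    ⟨not_isUnit_natCast_integerC (LocalField.valuation_adicCompletion_natCast_lt_one w₀.1 p hw₀)⟩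
  haveI := isAdicComplete_integerC_natCast (LocalField.valuation_adicCompletion_natCast_lt_one w₀.1 p hw₀)
  letI : Algebra (Place.Completion (K := ℚ) (Sum.inr ((Rat.HeightOneSpectrum.primesEquiv (R := 𝓞 ℚ)).symm ⟨p, Fact.out⟩)))
      (w₀.1.adicCompletion (CyclotomicField (cycLevel p k r) ℚ)) :=
    inferInstanceAs (Algebra (((Rat.HeightOneSpectrum.primesEquiv (R := 𝓞 ℚ)).symm ⟨p, Fact.out⟩).adicCompletion ℚ)
      (w₀.1.adicCompletion (CyclotomicField (cycLevel p k r) ℚ)))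
  apply LinearMap.ext
  intro y
  apply Ψ.injective
  funext w
  obtain ⟨φ'', hφ''⟩ := oneCocycleClass_surjective (subgroupRep (tateRep W p).toTopRep (cycSubgroup p k r))
    (conjMap (tateRep W p).toTopRep (cycSubgroup p k r) (g w) 1 y)
  obtain ⟨ψT, hψT⟩ := exists_level_towerCocycle W p ((Rat.HeightOneSpectrum.primesEquiv (R := 𝓞 ℚ)).symm ⟨p, Fact.out⟩)
    (w₀.1.adicCompletion (CyclotomicField (cycLevel p k r) ℚ)) (cycSubgroup p k r)
    (absGaloisRestrictTower_adicCompletion_mem_cycSubgroup_prime p k r w₀) φ''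
  rw [hdef w y φ'' ψT hφ'' hψT,
    cocycleDef_katoLambda W p k r w₀ Ψ hΨ hw₀ g hg dw hinjw hexw w y φ'' ψT hφ'' hψT]

end Unique

end Summit.BirchSwinnertonDyer.BirchSwinnertonDyer.Theorems.KimAtThreeFineKatoDefinedLambdaUnique

end
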